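import Mathlib
import Summits.Ventures.PercRepro2.SwOutAll
import Summits.Ventures.PercRepro2.SwOutArmFlip
import Summits.Ventures.PercRepro2.SwOutJunctionSplit

/-!
# Split-fine configurations (blind cell PercRepro2, night-4 g11, 2026-08-25; proofs/NIGHT4-G11.md §2)

A configuration is SPLIT-FINE (`SplitFine`) at the junction `u` when every copy of `u` lies in the
split hull of `h`, and MATCHED (`Matched`) when every edge at `u` (other than the edges to `h`) is
red iff its other end lies in `C_R(h)` and blue iff it lies in `C_B(h)`.  The two agree on the
classes of the junction theorem (`splitFine_of_matched`, `matched_of_splitFine`; a core at `u` is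
matched, `matched_of_core`).  On a split-fine configuration the split graph sees the clusters of
`h` exactly (`cluster_eq_of_splitFine`) and therefore the rigid edge sets
(`redEdges_eq_of_splitFine`, `blueEdges_eq_of_splitFine`).
-/

namespace Summit.Ventures.PercRepro2

namespace LocRows

open Hull

variable {V : Type*} {E : Type*} [Fintype E] [DecidableEq E]

open scoped Classical

/-! ## Split-fine configurations -/

section Fine

variable (ends : E → Sym2 V) (u h : V)

/-- **Split-fine**: all copies of `u` lie in the split hull of `h`. -/
def SplitFine (η : Config E) : Prop :=
  ∀ e, u ∈ ends e → Sum.inr e ∈ hull (splitEnds ends u) η (Sum.inl h)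

/-- **Matched**: every edge at `u` (other than the edges to `h`) is red iff its other end is in
`C_R(h)` and blue iff its other end is in `C_B(h)`. -/
def Matched (η : Config E) : Prop :=
  ∀ e (he : u ∈ ends e), Sym2.Mem.other he ≠ h →
    (η e = true → Sym2.Mem.other he ∈ cluster ends η h) ∧
    (η e = false → Sym2.Mem.other he ∈ cluster ends (blue η) h)

variable {ends u h}

omit [Fintype E] [DecidableEq E] in
/-- Split-fineness is colour-symmetric. -/
lemma splitFine_blue_iff {η : Config E} :
    SplitFine ends u h (blue η) ↔ SplitFine ends u h η := by
  simp only [SplitFine, hull_blue]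

omit [Fintype E] [DecidableEq E] in
/-- A copy in the split hull lies on the side of its own colour. -/
lemma inr_mem_cluster_split_of_splitFine {η : Config E} (hf : SplitFine ends u h η) {e : E}
    (he : u ∈ ends e) (hred : η e = true) :
    Sum.inr e ∈ cluster (splitEnds ends u) η (Sum.inl h) := by
  rcases hf e he with h1 | h1
  · exact h1
  · rw [inr_mem_cluster_split_iff he] at h1
    rw [blue_eq_true_iff] at h1
    rw [h1.1] at hred
    exact absurd hred (by simp)

omit [Fintype E] [DecidableEq E] in
/-- **The red cluster of `h` through the split** (split-fine, no loop at `u`, `h ≠ u`): a vertex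
other than `u` is in `C_R(h)` iff its copy is in the split cluster; `u` is in `C_R(h)` iff some
copy of a red edge at `u` is. -/
theorem cluster_eq_of_splitFine (hloop : ∀ e, ends e ≠ s(u, u)) (hhu : h ≠ u) {η : Config E}
    (hf : SplitFine ends u h η) :
    cluster ends η h =
      {x | x ≠ u ∧ Sum.inl x ∈ cluster (splitEnds ends u) η (Sum.inl h)} ∪
      {x | x = u ∧ ∃ e, ∃ _ : u ∈ ends e, η e = true ∧
        Sum.inr e ∈ cluster (splitEnds ends u) η (Sum.inl h)} := by
  apply Set.Subset.antisymm
  · intro x hx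
    refine mem_of_conn_of_closed (ends := ends) (ω := η) ?_
      (Or.inl ⟨hhu, mem_cluster_self _ _ _⟩) hx
    intro a ha b hab
    obtain ⟨hne, e, he, hends⟩ := openGraph_adj.1 hab
    rcases ha with ⟨hau, haC⟩ | ⟨rfl, e₁, he₁, hη₁, hC₁⟩
    · by_cases hbu : b = u
      · subst hbu
        have hue : b ∈ ends e := by rw [hends]; exact Sym2.mem_mk_right _ _
        have hoth : Sym2.Mem.other hue = a := other_eq_of_ends hue (ends_swap hends) hau
        right
        refine ⟨rfl, e, hue, he, ?_⟩
        rw [inr_mem_cluster_split_iff hue, hoth]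
        exact ⟨he, haC⟩
      · left
        exact ⟨hbu, mem_cluster_of_edge (v := Sum.inl h) haC he
          (splitEnds_eq_of_notMem hends hau hbu)⟩
    · -- `a = u`: the edge `e` is a red edge at `u`, its copy lies in the split hull
      have hue : a ∈ ends e := by rw [hends]; exact Sym2.mem_mk_left _ _
      have hoth : Sym2.Mem.other hue = b := other_eq_of_ends hue hends (Ne.symm hne)
      have hcopy := inr_mem_cluster_split_of_splitFine hf hue he
      rw [inr_mem_cluster_split_iff hue, hoth] at hcopy
      left
      exact ⟨Ne.symm hne, hcopy.2⟩
  · rintro x (⟨_, hx⟩ | ⟨rfl, e, he, hη, hC⟩)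
    · exact conn_of_conn_split_inl hx
    · obtain ⟨he', _, hc⟩ := conn_of_conn_split_inr hC
      exact mem_cluster_of_edge hc hη (ends_swap (ends_eq_other he'))

omit [Fintype E] [DecidableEq E] in
/-- The `inl`-membership half of `cluster_eq_of_splitFine`. -/
lemma inl_mem_cluster_split_iff_of_splitFine (hloop : ∀ e, ends e ≠ s(u, u)) (hhu : h ≠ u)
    {η : Config E} (hf : SplitFine ends u h η) {x : V} (hxu : x ≠ u) :
    Sum.inl x ∈ cluster (splitEnds ends u) η (Sum.inl h) ↔ x ∈ cluster ends η h := by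
  constructor
  · exact conn_of_conn_split_inl
  · intro hx
    rw [cluster_eq_of_splitFine hloop hhu hf] at hx
    rcases hx with ⟨_, h1⟩ | ⟨h1, _⟩
    · exact h1
    · exact absurd h1 hxu

omit [Fintype E] [DecidableEq E] in
/-- **The red edge set through the split** (split-fine, no loop at `u`, `h ≠ u`). -/
theorem redEdges_eq_of_splitFine (hloop : ∀ e, ends e ≠ s(u, u)) (hhu : h ≠ u) {η : Config E}
    (hf : SplitFine ends u h η) :
    redEdges ends η h = redEdges (splitEnds ends u) η (Sum.inl h) := by
  ext e
  simp only [mem_redEdges, mem_within]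
  constructor
  · rintro ⟨he, x, hx, y, hy, hxy⟩
    refine ⟨he, ?_⟩
    by_cases hu : u ∈ ends e
    · have hp : Sym2.Mem.other hu ∈ cluster ends η h := by
        have h1 : s(u, Sym2.Mem.other hu) = s(x, y) := (Sym2.other_spec hu).trans hxy
        rw [Sym2.eq_iff] at h1
        rcases h1 with ⟨_, h2⟩ | ⟨_, h2⟩
        · rw [h2]; exact hy
        · rw [h2]; exact hx
      have hpu := other_ne_u hloop hu
      have hp' : Sum.inl (Sym2.Mem.other hu) ∈ cluster (splitEnds ends u) η (Sum.inl h) :=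
        (inl_mem_cluster_split_iff_of_splitFine hloop hhu hf hpu).2 hp
      refine ⟨Sum.inl (Sym2.Mem.other hu), hp', Sum.inr e, ?_, splitEnds_of_mem hu⟩
      rw [inr_mem_cluster_split_iff hu]
      exact ⟨he, hp'⟩
    · have hxu : x ≠ u := fun h' => hu (by rw [hxy, ← h']; exact Sym2.mem_mk_left _ _)
      have hyu : y ≠ u := fun h' => hu (by rw [hxy, ← h']; exact Sym2.mem_mk_right _ _)
      exact ⟨Sum.inl x, (inl_mem_cluster_split_iff_of_splitFine hloop hhu hf hxu).2 hx,
        Sum.inl y, (inl_mem_cluster_split_iff_of_splitFine hloop hhu hf hyu).2 hy,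
        splitEnds_eq_of_notMem hxy hxu hyu⟩
  · rintro ⟨he, x', hx', y', hy', hxy⟩
    refine ⟨he, ?_⟩
    by_cases hu : u ∈ ends e
    · rw [splitEnds_of_mem hu, Sym2.eq_iff] at hxy
      have hp : Sum.inl (Sym2.Mem.other hu) ∈ cluster (splitEnds ends u) η (Sum.inl h) := by
        rcases hxy with ⟨h1, _⟩ | ⟨h1, _⟩
        · rw [h1]; exact hx'
        · rw [h1]; exact hy'
      have hpT : Sym2.Mem.other hu ∈ cluster ends η h := conn_of_conn_split_inl hp
      refine ⟨Sym2.Mem.other hu, hpT, u, ?_, ends_swap (ends_eq_other hu)⟩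
      exact mem_cluster_of_edge hpT he (ends_swap (ends_eq_other hu))
    · obtain ⟨p, q, hpq⟩ := exists_pair (ends e)
      rw [splitEnds_of_notMem hu, hpq, Sym2.map_mk, Sym2.eq_iff] at hxy
      rcases hxy with ⟨h1, h2⟩ | ⟨h1, h2⟩
      · rw [← h1] at hx'; rw [← h2] at hy'
        exact ⟨p, conn_of_conn_split_inl hx', q, conn_of_conn_split_inl hy', hpq⟩
      · rw [← h1] at hy'; rw [← h2] at hx'
        exact ⟨p, conn_of_conn_split_inl hy', q, conn_of_conn_split_inl hx', hpq⟩

omit [Fintype E] [DecidableEq E] in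
/-- **The blue edge set through the split.** -/
theorem blueEdges_eq_of_splitFine (hloop : ∀ e, ends e ≠ s(u, u)) (hhu : h ≠ u) {η : Config E}
    (hf : SplitFine ends u h η) :
    blueEdges ends η h = blueEdges (splitEnds ends u) η (Sum.inl h) :=
  redEdges_eq_of_splitFine hloop hhu (splitFine_blue_iff.2 hf)

omit [Fintype E] [DecidableEq E] in
/-- The copy `inl u` is isolated in the split graph: it lies in no split cluster but its own. -/
lemma inl_u_notMem_cluster_split (hloop : ∀ e, ends e ≠ s(u, u)) {ω : Config E} {a : V}
    (hau : a ≠ u) : Sum.inl u ∉ cluster (splitEnds ends u) ω (Sum.inl a) := by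
  intro hmem
  have key : cluster (splitEnds ends u) ω (Sum.inl a) ⊆ {v' | v' ≠ Sum.inl u} := by
    intro v' hv'
    refine mem_of_conn_of_closed (ends := splitEnds ends u) (ω := ω) ?_
      (fun h' => hau (Sum.inl.inj h')) hv'
    intro x' _ y' hxy
    obtain ⟨_, e, _, hends⟩ := openGraph_adj.1 hxy
    intro hy
    subst hy
    exact inl_u_not_mem_splitEnds hloop e (by rw [hends]; exact Sym2.mem_mk_right _ _)
  exact key hmem rfl

omit [Fintype E] [DecidableEq E] in
/-- **Matched gives split-fine** (no loop at `u`, `h ≠ u`, every neighbour `p ≠ h` of `u` adjacent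
to `h`, cores only at `h` or `u`). -/
theorem splitFine_of_matched (hloop : ∀ e, ends e ≠ s(u, u)) (hhu : h ≠ u)
    (hadj : ∀ e (he : u ∈ ends e), Sym2.Mem.other he ≠ h →
      ∃ e', ends e' = s(Sym2.Mem.other he, h))
    {η : Config E}
    (hcore : ∀ x, x ∈ cluster ends η h → x ∈ cluster ends (blue η) h → x = h ∨ x = u)
    (hm : Matched ends u h η) : SplitFine ends u h η := by
  intro e he
  have hpu := other_ne_u hloop he
  by_cases hph : Sym2.Mem.other he = h
  · cases hc : η e with
    | true =>
      left
      rw [inr_mem_cluster_split_iff he, hph]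
      exact ⟨hc, mem_cluster_self _ _ _⟩
    | false =>
      right
      rw [inr_mem_cluster_split_iff he, hph]
      exact ⟨by rw [blue_eq_true_iff]; exact hc, mem_cluster_self _ _ _⟩
  · obtain ⟨e', he'⟩ := hadj e he hph
    have hne' : u ∉ ends e' := by
      rw [he', Sym2.mem_iff]; rintro (h1 | h1)
      · exact hpu h1.symm
      · exact hhu h1.symm
    cases hc : η e with
    | true =>
      have hp : Sym2.Mem.other he ∈ cluster ends η h := (hm e he hph).1 hc
      left
      rw [inr_mem_cluster_split_iff he]
      refine ⟨hc, ?_⟩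
      cases hc' : η e' with
      | true =>
        exact mem_cluster_of_edge (mem_cluster_self _ _ _) hc'
          (splitEnds_eq_of_notMem (ends_swap he') hhu hpu)
      | false =>
        have hb : blue η e' = true := by rw [blue_eq_true_iff]; exact hc'
        have hp' : Sym2.Mem.other he ∈ cluster ends (blue η) h :=
          mem_cluster_of_edge (mem_cluster_self _ _ _) hb (ends_swap he')
        rcases hcore _ hp hp' with h1 | h1
        · exact absurd h1 hph
        · exact absurd h1 hpu
    | false =>
      have hp : Sym2.Mem.other he ∈ cluster ends (blue η) h := (hm e he hph).2 hc
      right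
      rw [inr_mem_cluster_split_iff he]
      refine ⟨by rw [blue_eq_true_iff]; exact hc, ?_⟩
      cases hc' : η e' with
      | true =>
        have hp' : Sym2.Mem.other he ∈ cluster ends η h :=
          mem_cluster_of_edge (mem_cluster_self _ _ _) hc' (ends_swap he')
        rcases hcore _ hp' hp with h1 | h1
        · exact absurd h1 hph
        · exact absurd h1 hpu
      | false =>
        have hb : blue η e' = true := by rw [blue_eq_true_iff]; exact hc'
        exact mem_cluster_of_edge (mem_cluster_self _ _ _) hb
          (splitEnds_eq_of_notMem (ends_swap he') hhu hpu)

omit [Fintype E] [DecidableEq E] in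
/-- **Split-fine gives matched.** -/
theorem matched_of_splitFine {η : Config E} (hf : SplitFine ends u h η) : Matched ends u h η := by
  intro e he _
  constructor
  · intro hc
    have h1 := inr_mem_cluster_split_of_splitFine hf he hc
    rw [inr_mem_cluster_split_iff he] at h1
    exact conn_of_conn_split_inl h1.2
  · intro hc
    have hb : blue η e = true := by rw [blue_eq_true_iff]; exact hc
    have h1 := inr_mem_cluster_split_of_splitFine (splitFine_blue_iff.2 hf) he hb
    rw [inr_mem_cluster_split_iff he] at h1
    exact conn_of_conn_split_inl h1.2

omit [Fintype E] [DecidableEq E] in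
/-- A core at `u` is matched. -/
theorem matched_of_core {η : Config E} (hT : u ∈ cluster ends η h)
    (hTp : u ∈ cluster ends (blue η) h) : Matched ends u h η := by
  intro e he _
  constructor
  · intro hc
    exact mem_cluster_of_edge hT hc (ends_eq_other he)
  · intro hc
    have hb : blue η e = true := by rw [blue_eq_true_iff]; exact hc
    exact mem_cluster_of_edge hTp hb (ends_eq_other he)

end Fine

end LocRows

end Summit.Ventures.PercRepro2
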